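import Literature.MathematicalPhysics.QuantumFieldTheory.Balaban1983to89.B9Eq326LocalPartBlockDecayTowerClosedRadius
import Literature.MathematicalPhysics.QuantumFieldTheory.Balaban1983to89.B9Eq326LocalPartCoerciveTower
import Literature.MathematicalPhysics.QuantumFieldTheory.Balaban1983to89.B9Eq3126H1RowLettersDiagonalClosed

/-!
# `Balaban1983to89.B9Eq326LocalPartBlockDecayTowerDiagonalClosed` — T. Bałaban, *Propagators for lattice gauge theories in a background field*, Commun. Math.
# Phys. **99** (1985) 389–434 [Balaban1985BackgroundPropagators] (3.26) p. 395 (the local part `A₀ = Δ(U) + D_UD*_U + Q*aQ`), Thm 3.11 p. 416, (3.49) p. 399 («the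
# constants … independent of the field configuration»), (3.35)–(3.37) p. 396, with [Balaban1985Variational] (134)–(136) p. 298: **THE FULLY CLOSED `L²` BIG-BLOCK
# DECAY OF THE TOWER LOCAL PART ON PRINT's DIAGONAL — `∃ α₀ r₁ A` BEFORE `∀ n η c₀ c₁ m U`: `‖P_{y₁} ∘ A₀,k⁻¹ ∘ P_{y₀}‖ ≤ A·e^{−r₁·d_m(y₀,y₁)}` for EVERY height,
# spacing, weights, lattice and background of the MODEL letters in ONE window `α ≤ α₀` and EVERY positivity witness `hpos₀` of the local part** — (EA0TC)
# `exists_rate_block_decay_localInvK_closed` at the letters of this lineage's (LDC) `B9Eq3126H1RowLettersDiagonalClosed.exists_H1_row_letters_diagonal_closed`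
# (`γ` for `Δ_{a,k}` — passed to the local part by (LPC) `localK_coercive_of_coercive` —, the curvature letter at `δ := αη²`, the idle `γ′, κ₁, M`), `hRS` from
# unitarity; rate `r₁ = r₀`, constant `A = (4∕γ)e^{r₀}`: the (D-E)₀,k letter `hdec` of (EA0S) `B9Eq326LocalPartTowerSupDecay` INHABITED — the local-part twin of
# (FCLG) `B9Eq326DeltaABlockDecayTowerDiagonalClosed`

statement-level skeleton of published theorems with citation tags; proofs where landed; nothing here is a claim about the Yang–Mills mass gap

CITATION HEADER (lean-in-tree rule).  Audit cell `pub-balaban`, sub-cell `t4`, BINDER row NE9 (road ΔA-CT, leaf prover 03 `b2b-balaban-t4-ne9-formalise-leaf-03`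
gen 78).  Imports BY NAME this lineage's (EA0TC) `B9Eq326LocalPartBlockDecayTowerClosedRadius`, (LPC) `B9Eq326LocalPartCoerciveTower`, (LDC)
`B9Eq3126H1RowLettersDiagonalClosed`.  Sources READ first-hand: [Balaban1985BackgroundPropagators] (`paper:balaban1985-cmp99-background-propagators`) p. 393, p. 395.
Print's decay is the random walk of Sect. C; the cell's road is Combes–Thomas with explicit windows; `r₁` is the cell's closed form, NOT print's `δ₀`.

WHAT IS PROVED (sorry-free; proof lane — no `def`; [folklore] composition BY NAME).
* **`exists_block_decay_localInvK_diagonal_closed`** — the display above; NO coercivity ∕ floor ∕ size ∕ conjugation ∕ window ∕ rate letter displayed, only print's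
  running axioms (E162 data, unitarity, the diagonal, `|η|^d∕c₀ ≤ ρ_w`, the window `‖U(b) − 1‖ ≤ αη`, `‖U(∂p) − 1‖ ≤ αη²`, `ε_j ≤ αϱ^j`, `α ≤ α₀`) and the
  positivity witness `hpos₀` that DEFINES `A₀,k⁻¹`.
HONEST SCOPE.  Composition; crude constants; `L²`-operator currency (NOT print's pointwise kernel bound, NOT print's `δ₀`); NOT NE9 (cell pub-balaban: NE9 NOT
PRINTED ∕ NOT PROVED; «NE9 ⇐ the named binders»; row WALLED ON A MODEL (O-NE9-1; #5 UNRULED); spine PROVED 0∕9; rung (B)+1 on a finite T⁴ — NOT infinite volume,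
NOT mass gap, NOT BetaPertH, NOT Clay; HONEST DEPENDENCY: continuum YM on T⁴ ⇐ BetaPertH ∧ nine spine estimates (0/9 proved); BetaPertH ⇐ (D1) ∧ (D4) ∧ CAP+tail;
G-an2-4 gates asym, D1 and NE2/3/4).  NEW file; nothing modified.  Net new unproved facts: 0.
-/

noncomputable section

set_option autoImplicit false

open scoped InnerProductSpace ComplexConjugate BigOperators
open NormedSpace

namespace Literature.MathematicalPhysics.QuantumFieldTheory.Balaban1983to89.B9Eq326LocalPartBlockDecayTowerDiagonalClosed

open B4Sect5Torus (TSite tdist)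
open B4Sect5Proof (latticeConst)
open B9SectCLatticeCarrier (Bond DirPair bpos btgt)
open B9Eq311L2Pairing (WL2)
open B9Eq319QprimeTorus (fineP blockCoord)
open B9Eq315QTower (towerP UlevOf)
open B9Eq315QTorus (perCfg cornerSite)
open B7Prop1Explicit (U1 Wcx boxVec)
open B9Eq316TowerFlatIsOneStep (siteCast towerP_eq_fineP_pow)
open B11Eq103H1Complex (SiteL2K BondL2K)
open B9Eq310DeltaPrime (plaqHolU)
open B9Eq310HessianOperator (adTransportW)
open B9Eq310HessianHermitian (adTransportW_adjoint)
open B9Eq326OperatorTower (laplaceAk QkW)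
open B11Eq103H1Complex (greenK covDerivL2K covDivL2K)
open B9Eq310HessianOperator (hessOp)
open B9Eq326LocalPartCoerciveTower (localK_coercive_of_coercive)
open B9Eq326LocalPartBlockDecayTowerClosedRadius (exists_rate_block_decay_localInvK_closed)
open B9Eq3126H1RowLettersDiagonalClosed (exists_H1_row_letters_diagonal_closed)

variable {d : ℕ} (hd : 1 ≤ d) (L : ℕ) [NeZero L] (hL : 1 ≤ L) (hL3 : 3 ≤ L)
  {𝔸 : Type*} [NormedRing 𝔸] [NormedAlgebra ℂ 𝔸] [CompleteSpace 𝔸] [NormOneClass 𝔸] [StarRing 𝔸] [NormedStarGroup 𝔸] [StarModule ℂ 𝔸]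
  {W : Type*} [NormedAddCommGroup W] [InnerProductSpace ℂ W] [FiniteDimensional ℂ W] (φ : W ≃ₗ[ℂ] 𝔸)
  {Mφ Mφ' : ℝ} (hMφ : 0 ≤ Mφ) (hMφ' : 0 ≤ Mφ') (hφ : ∀ w, ‖φ w‖ ≤ Mφ * ‖w‖) (hφ' : ∀ X, ‖φ.symm X‖ ≤ Mφ' * ‖X‖) (hstar : ∀ X : 𝔸, ‖star X‖ ≤ ‖X‖)
  {a : ℝ} (ha : 0 < a) {a' : ℝ} (ha' : 0 < a') {ϱ : ℝ} (hϱ0 : 0 ≤ ϱ) (hϱ1 : ϱ < 1)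
  (τ : 𝔸 →ₗ[ℂ] ℂ) {Cτ : ℝ} (hτ : ∀ X, ‖τ X‖ ≤ Cτ * ‖X‖) (hCτ : 0 ≤ Cτ) {Mτ : ℝ} (hτm : ∀ X Y : 𝔸, ‖τ (X * Y)‖ ≤ Mτ * ‖X‖ * ‖Y‖) (hMτ : 0 ≤ Mτ)
  {ρw : ℝ} (hρw : 0 ≤ ρw)
  (hτ₁ : ∀ X : 𝔸, τ (star X) = conj (τ X)) (hτ₂ : ∀ X Y : 𝔸, τ (X * Y) = τ (Y * X)) (hφτ : ∀ X Y : 𝔸, ⟪φ.symm X, φ.symm Y⟫_ℂ = τ (star X * Y))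

set_option maxHeartbeats 800000 in
include hd hL hL3 hMφ hMφ' hφ hφ' hstar ha ha' hϱ0 hϱ1 hτ hCτ hτm hMτ hρw hτ₁ hτ₂ hφτ in
/-- **THE `L²` BIG-BLOCK DECAY OF THE TOWER LOCAL PART `A₀,k⁻¹` ON THE DIAGONAL, FULLY CLOSED — `∃ α₀ r₁ A` BEFORE `∀ n η c₀ c₁ m U`.**
(EA0TC) `exists_rate_block_decay_localInvK_closed` at the letters of (LDC) `exists_H1_row_letters_diagonal_closed` (`γ` — a `γ` for the local part by (LPC) —,
the idle `γ′, κ₁, M`, the curvature letter at `δ := αη²`, `ε_s := α₀`, `p_K⁰ := 768·|DirPair d|·M_τM_φ²ρ_w·α₀ < γ∕2`), `hRS` from unitarity; `r₁ = r₀`, `A = (4∕γ)e^{r₀}`;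
the positivity witness `hpos₀` of `A₀` is ANY. [cite: Balaban1985BackgroundPropagators, (3.26) p.395, Thm 3.11 p.416, (3.49) p.399, (3.35)–(3.37) p.396;
Balaban1985Variational, (134)–(136) p.298] -/
theorem exists_block_decay_localInvK_diagonal_closed :
    ∃ α₀ r₁ A : ℝ, 0 < α₀ ∧ 0 < r₁ ∧ 0 ≤ A ∧
      ∀ (n : ℕ) (η : ℝ) (_hηL : η * (L : ℝ) ^ (n + 1) = 1) (c₀ c₁ : ℝ) [Fact (0 < c₀)] [Fact (0 < c₁)]
        (_hw : c₀ * ((L : ℝ) ^ (n + 1)) ^ d = c₁) (_hρ : |η| ^ d / c₀ ≤ ρw) (m : Fin d → ℕ) [∀ i, NeZero (m i)] (_hm : ∀ i, 1 ≤ m i)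
        (U : Bond d (towerP L m (n + 1)) → 𝔸ˣ) (αU : ℕ → ℝ) (_hα0 : ∀ j, 0 ≤ αU j) (hα1 : ∀ j, αU j ≤ 1 / 64)
        (hU1 : ∀ (j : ℕ) (x : B7Prop1Explicit.Site d) (k : Fin d), perCfg (towerP L m (j + 1)) (UlevOf L m (n + 1) U j) x k ∈ U1 𝔸)
        (hreg : ∀ (j : ℕ) (y : TSite d (towerP L m j)) (k : Fin d) (ρ' : Fin d → Fin L),
          ‖((Wcx L (perCfg (towerP L m (j + 1)) (UlevOf L m (n + 1) U j)) (cornerSite L y) k (boxVec L ρ') : 𝔸ˣ) : 𝔸) - 1‖ ≤ αU j)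
        (εU : ℕ → ℝ) (_hεU : ∀ j, 0 ≤ εU j) (_hUε : ∀ (j : ℕ) (b : Bond d (towerP L m (j + 1))), ‖(UlevOf L m (n + 1) U j b : 𝔸) - 1‖ ≤ εU j)
        (_hLb : ∀ (j : ℕ) (b : Bond d (towerP L m (j + 1))), UlevOf L m (n + 1) U j b ∈ U1 𝔸)
        (α : ℝ) (_hα : 0 ≤ α) (_hαle : α ≤ α₀)
        (_hUst : ∀ b, star (U b : 𝔸) = (((U b)⁻¹ : 𝔸ˣ) : 𝔸)) (_hUb : ∀ b, U b ∈ U1 𝔸) (_hUη : ∀ b, ‖(U b : 𝔸) - 1‖ ≤ α * η)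
        (_hpl : ∀ p : B9SectCLatticeCarrier.Plaq d (towerP L m (n + 1)), ‖(plaqHolU U p : 𝔸) - 1‖ ≤ α * η ^ 2)
        (_hεg : ∀ j < n + 1, εU j ≤ α * ϱ ^ j)
        (A₀ : BondL2K ℂ d (towerP L m (n + 1)) c₀ W →ₗ[ℂ] BondL2K ℂ d (towerP L m (n + 1)) c₀ W)
        (hA₀ : A₀ = hessOp φ η U τ + covDerivL2K ℂ c₀ ((η : ℂ))⁻¹ (adTransportW φ U) ∘ₗ covDivL2K ℂ c₀ ((η : ℂ))⁻¹ (adTransportW φ fun b => (U b)⁻¹) +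
          LinearMap.adjoint (QkW L m n φ U hL αU hα1 hU1 hreg (c₀ := c₀) (c₁ := c₁)) ∘ₗ ((a : ℂ) • QkW L m n φ U hL αU hα1 hU1 hreg (c₀ := c₀) (c₁ := c₁)))
        (hpos₀ : ∀ x : BondL2K ℂ d (towerP L m (n + 1)) c₀ W, x ≠ 0 → 0 < RCLike.re ⟪x, A₀ x⟫_ℂ)
        (PB : TSite d m → BondL2K ℂ d (towerP L m (n + 1)) c₀ W →L[ℂ] BondL2K ℂ d (towerP L m (n + 1)) c₀ W)
        (_hPB : ∀ (y : TSite d m) (f : BondL2K ℂ d (towerP L m (n + 1)) c₀ W) (b : Bond d (towerP L m (n + 1))),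
          WL2.equiv ℂ (fun _ : Bond d (towerP L m (n + 1)) => c₀) W (PB y f) b =
            if blockCoord (L ^ (n + 1)) m (siteCast (towerP_eq_fineP_pow L m (n + 1)) (bpos b)) = y then
              WL2.equiv ℂ (fun _ : Bond d (towerP L m (n + 1)) => c₀) W f b else 0)
        (y₀ y₁ : TSite d m),
        ‖PB y₁ ∘L LinearMap.toContinuousLinearMap (greenK A₀ hpos₀) ∘L PB y₀‖ ≤
          A * Real.exp (-(r₁ * tdist m y₀ y₁)) := by
  have hL2 : 2 ≤ L := le_trans (by norm_num) hL3
  -- the six letters, closed in one window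
  obtain ⟨α₀, γ, μ₁, γ', κ₁, M, hα₀, hγ, -, -, hγ', hγ'1, hκ₁, hM, hgap, HL⟩ :=
    exists_H1_row_letters_diagonal_closed hd L hL hL3 φ hMφ hMφ' hφ hφ' ha ha' hϱ0 hϱ1 τ hτ hCτ hρw hτ₁ hτ₂ hφτ hMτ
  have hP0 : 0 ≤ 768 * Fintype.card (DirPair d) * Mτ * Mφ ^ 2 * ρw * α₀ := by positivity
  -- the radius, chosen once
  obtain ⟨r₀, -, hr₀, HE⟩ := exists_rate_block_decay_localInvK_closed L hL2 φ hφ hφ' hMφ hMφ' hstar τ hτm hMτ a ha.le ha'.le hϱ0 hϱ1 hα₀.le hγ' hκ₁ hM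
    hγ hP0 hgap d
  refine ⟨α₀, r₀, 4 / γ * Real.exp r₀, hα₀, hr₀, by positivity, ?_⟩
  intro n η hηL c₀ c₁ _ _ hw hρ m _ hm U αU hαU0 hα1 hU1 hreg εU hεU hUε hLb α hα hαle hUst hUb hUη hpl hεg A₀ hA₀ hpos₀ PB hPB y₀ y₁
  obtain ⟨hcoer, -, -, -, -, -, hRe, hIm, hpK⟩ :=
    HL n η hηL c₀ c₁ hw hρ m U αU hα1 hU1 hreg εU hεU hUε hLb hα hαle hUst hUb hUη hpl hεg
  have hRS : ∀ (b : Bond d (towerP L m (n + 1))) (v u : W), ⟪adTransportW φ U b v, u⟫_ℂ = ⟪v, adTransportW φ (fun b => (U b)⁻¹) b u⟫_ℂ :=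
    adTransportW_adjoint φ τ hτ₂ hUst hφτ
  have hη : 0 < η := by
    have hLp : (0 : ℝ) < (L : ℝ) ^ (n + 1) := by positivity
    by_contra h
    have : η * (L : ℝ) ^ (n + 1) ≤ 0 := mul_nonpos_of_nonpos_of_nonneg (not_lt.mp h) hLp.le
    linarith
  have hεg' : ∀ j < n + 1, εU j ≤ α₀ * ϱ ^ j := fun j hj => (hεg j hj).trans (mul_le_mul_of_nonneg_right hαle (pow_nonneg hϱ0 j))
  have hδ : 0 ≤ α * η ^ 2 := by positivity
  have hcoer₀ := localK_coercive_of_coercive L m n φ η U τ hRS hL αU hα1 hU1 hreg a A₀ hA₀ hcoer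
  exact HE n η hη hηL c₀ c₁ hw m hm U hUb hRS αU hαU0 hα1 hU1 hreg εU hεU hUε hεg' (α * η ^ 2) hδ hRe hIm hpK A₀ hA₀ hpos₀ hcoer₀ PB hPB y₀ y₁

end Literature.MathematicalPhysics.QuantumFieldTheory.Balaban1983to89.B9Eq326LocalPartBlockDecayTowerDiagonalClosed

end
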